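import Summits.BirchSwinnertonDyer.BirchSwinnertonDyer.Theorems.SignedLowerHalvesSmallImageLowerHalfBothSignsRttD2SeqJunctionSocket
import HarnessLib

/-!
# Route `SignedLowerHalves`, crux L `SmallImageLowerHalfBothSigns` (stmt-BirchSwinnertonDyer-23599), line `rtt_w3` v14 → v15 — E2, row (6′)/J3
# IN EXACTNESS FORM: the junction `j₀ : B →ₗ[Λ_𝒪] DQ.X` WITH `Function.Exact j₀ gX` from the three Galois inputs of the Pontryagin side
# (pairing `P` with `hPX`/`hPC`, reciprocity `hrec`, Poitou–Tate annihilator `hPT`) — the shape asked by the LEAD's `charRoad_E2_of_junction_tails` (p782790)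

WIDTH seat `bsd-line-slh-p3-w3` g21 under LEAD `cruxlead-stmt-BirchSwinnertonDyer-23599` g11 (cell `bsd-ssimc`; KEY «J3 in exactness form» for the -w3
line, 2026-08-30T17:57:50Z / OUTPUT SHAPE 18:53:25Z); helper `--supports stmt-BirchSwinnertonDyer-23599`. THEOREMS ONLY (no definition, no named fact,
no instance, no `sorry`). HONEST FRAMING: this is GLUE — the research inputs of J3 (the local Tate pairing over the tower `P`, its laws, global reciprocity
and the Poitou–Tate annihilator identity) remain HYPOTHESES; E2, crux L, crux M and BSD remain OPEN and are proved for NO curve.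

WHAT. -w3 g20's junction socket (`…RttD2SeqJunctionSocket`, p779548) produces from a pairing map `P : B →+ Hom(E^{ε}_{sat,v}, ℚ/ℤ)` (intended
`b ↦ ⟨loc_v b, ·⟩_v`) with `hrec` (reciprocity: `P b` kills `loc_v(Sel)`), `hPX`/`hPC` (the `Λ_𝒪`-laws) a `Λ_𝒪`-linear `jn : B →ₗ ker gX` with
`DQ.toDual ∘ jn = P`, surjective when `hPT` (every character killing `loc_v(Sel)` is a `P b`). The v15 consumer `charRoad_E2_of_junction_tails` wants
instead `j₀ : B →ₗ[Λ_𝒪] DQ.X` with `Function.Exact j₀ gX`. ★★ `exists_junction_exact`: `j₀ := ker.subtype ∘ jn`; exactness = `range j₀ = ker gX`, the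
inclusion `⊇` being the annihilator argument (`gXHom_eq_zero_iff` + `hPT` + injectivity of `DQ.toDual`).
References: [Kobayashi2003] Thm. 7.3 i); [Rubin2000] Thm. 1.7.3 (Poitou–Tate, annihilators); [Washington1997] §13.2.
-/

set_option autoImplicit false
set_option linter.dupNamespace false -- D-0017: single-problem summit, the namespace repeats the problem name by design
noncomputable section

open scoped Classical
open NumberField IsDedekindDomain Field

universe u

namespace Summit.BirchSwinnertonDyer.BirchSwinnertonDyer.Theorems.SmallImageRttD2Seq

open Literature.NumberTheory.EllipticCurves Literature.NumberTheory.EllipticCurves.Kobayashi2003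
  Literature.NumberTheory.EllipticCurves.GreenbergVatsal2000 Literature.NumberTheory.GaloisRepresentations
  Summit.BirchSwinnertonDyer.BirchSwinnertonDyer.Theorems.SmallImageCharSignedSelmer

section J3Exact

variable {K : Type u} [Field K] [NumberField K] {p : ℕ} [Fact p.Prime] {κ : ZpExtension K p} {γ : absoluteGaloisGroup K}
  (S : Set (PadicAlgCl p)) [FiniteDimensional ℚ_[p] (padicCoeffField S)]
  {M : Type u} [AddCommGroup M] [DistribMulAction (absoluteGaloisGroup K) M] [TopologicalSpace M] [DiscreteTopology M]
  [Module (padicCoeffIntegers S) M] [SMulCommClass (absoluteGaloisGroup K) (padicCoeffIntegers S) M]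
  {V : WeierstrassCurve K} {j : V.geomPrimaryTorsion p →+ M} {S₀ : Set (HeightOneSpectrum (𝓞 K))} {ε : ℤˣ}
  (D : SignedTransportDualDataSat κ γ M (padicCoeffIntegers S) V j S₀ ε)
  {v : HeightOneSpectrum (𝓞 K)} [DistribMulAction (absoluteGaloisGroup (v.adicCompletion K)) M]
  [SMulCommClass (absoluteGaloisGroup (v.adicCompletion K)) (padicCoeffIntegers S) M]
  {γv : absoluteGaloisGroup (v.adicCompletion K)} (DQ : LocalCondDualData κ M (padicCoeffIntegers S) V j ε v γv)
  (hres : ∀ (σ : absoluteGaloisGroup (v.adicCompletion K)) (m : M), σ • m = resGalOfEmb (closureEmb (K := K) (v.adicCompletion K)) σ • m)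
  (hvp : (p : 𝓞 K) ∈ v.asIdeal)
  {B : Type*} [AddCommGroup B] [Module (IwasawaAlgebraO S) B] (P : B →+ (localCondInftySat κ M (padicCoeffIntegers S) V j ε v →+ AddCircle (1 : ℚ)))

/-- ★★ **J3 in exactness form.** Under the hypotheses of the junction socket `exists_junction_linearMap` (pinned `Λ_𝒪`-structures `instX`/`instQ`, pairing
`P : B → (E^{ε}_{sat,v})^∨` with the laws `hPX`/`hPC`, reciprocity `hrec`) AND the Poitou–Tate annihilator identity `hPT` (every character of `E^{ε}_{sat,v}`
vanishing on `loc_v(Sel)` is `P b` for some `b`), there is a `Λ_𝒪`-linear `j₀ : B →ₗ DQ.X` with `DQ.toDual ∘ j₀ = P` and `Function.Exact j₀ gX` for the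
transpose `gX = loc_v^∨ = gXLinearMapO …` — the binders `j₀`/exactness of `charRoad_E2_of_roadD_junction_exact` (p780454) / `charRoad_E2_of_junction_tails`
(p782790). [cite: Kobayashi2003, Thm. 7.3 i)] [cite: Rubin2000, Thm. 1.7.3] [cite: Washington1997, §13.2] -/
theorem exists_junction_exact (instX : Module (IwasawaAlgebraO S) D.X) (instQ : Module (IwasawaAlgebraO S) DQ.X)
    (hιX : ∀ (f : IwasawaAlgebra p) (x : D.X), (letI := instX; iwasawaToIwasawaO S f • x) = f • x)
    (hιQ : ∀ (f : IwasawaAlgebra p) (x : DQ.X), (letI := instQ; iwasawaToIwasawaO S f • x) = f • x)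
    (hCX : ∀ (a : padicCoeffIntegers S) (x : D.X) (s : signedTransportSelmerInftySat κ M (padicCoeffIntegers S) V j S₀ ε),
      D.toDual (letI := instX; (PowerSeries.C a : IwasawaAlgebraO S) • x) s =
        D.toDual x ⟨GreenbergSelmer.scalarH1 κ.kerSubgroup M a s, scalarH1_mem_signedTransportSelmerInftySat κ M (padicCoeffIntegers S) V j S₀ ε a s.2⟩)
    (hCQ : ∀ (a : padicCoeffIntegers S) (x : DQ.X) (c : localCondInftySat κ M (padicCoeffIntegers S) V j ε v),
      DQ.toDual (letI := instQ; (PowerSeries.C a : IwasawaAlgebraO S) • x) c = DQ.toDual x (scalarLocalSat κ M (padicCoeffIntegers S) V j ε v a c))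
    (htor : ∀ m : M, ∃ k : ℕ, p ^ k • m = 0)
    (hstabK : ∀ m : M, IsOpen (MulAction.stabilizer (absoluteGaloisGroup K) m : Set (absoluteGaloisGroup K)))
    (hstab : ∀ m : M, IsOpen (MulAction.stabilizer (absoluteGaloisGroup (v.adicCompletion K)) m : Set (absoluteGaloisGroup (v.adicCompletion K))))
    (hγ : κ.IsTopGenerator γ) (hv : AcSigned.IsNonsplitIn κ v) (hγv : κ.IsTopGenerator (resGalOfEmb (closureEmb (K := K) (v.adicCompletion K)) γv))
    (hrec : ∀ (b : B) (s : signedTransportSelmerInftySat κ M (padicCoeffIntegers S) V j S₀ ε),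
      P b (locSat κ M (padicCoeffIntegers S) V j S₀ ε v hres hvp s) = 0)
    (hPX : ∀ (b : B) (c : localCondInftySat κ M (padicCoeffIntegers S) V j ε v),
      P ((PowerSeries.X : IwasawaAlgebraO S) • b) c = P b ((conjLocalSat κ M (padicCoeffIntegers S) V j ε v γv - 1) c))
    (hPC : ∀ (a : padicCoeffIntegers S) (b : B) (c : localCondInftySat κ M (padicCoeffIntegers S) V j ε v),
      P ((PowerSeries.C a : IwasawaAlgebraO S) • b) c = P b (scalarLocalSat κ M (padicCoeffIntegers S) V j ε v a c))
    (hPT : ∀ q : localCondInftySat κ M (padicCoeffIntegers S) V j ε v →+ AddCircle (1 : ℚ),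
      (∀ s : signedTransportSelmerInftySat κ M (padicCoeffIntegers S) V j S₀ ε, q (locSat κ M (padicCoeffIntegers S) V j S₀ ε v hres hvp s) = 0) →
        ∃ b : B, P b = q) :
    letI := instX; letI := instQ
    ∃ j₀ : B →ₗ[IwasawaAlgebraO S] DQ.X, (∀ b : B, DQ.toDual (j₀ b) = P b) ∧
      Function.Exact j₀ (gXLinearMapO S D DQ hres hvp instX instQ hιX hιQ hCX hCQ htor hstabK hstab hγ hv hγv) := by
  letI := instX; letI := instQ
  obtain ⟨jn, hjn⟩ := exists_junction_linearMap S D DQ hres hvp P instX instQ hιX hιQ hCX hCQ htor hstabK hstab hγ hv hγv hrec hPX hPC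
  refine ⟨(LinearMap.ker (gXLinearMapO S D DQ hres hvp instX instQ hιX hιQ hCX hCQ htor hstabK hstab hγ hv hγv)).subtype.comp jn,
    fun b ↦ hjn b, fun x ↦ ⟨fun hx ↦ ?_, ?_⟩⟩
  · -- `gX x = 0`: the character `DQ.toDual x` kills `loc_v(Sel)`, hence is `P b`, and `jn b = x`
    have hx' : gXHom D DQ hres hvp x = 0 := by rwa [gXLinearMapO_apply] at hx
    obtain ⟨b, hb⟩ := hPT (DQ.toDual x) ((gXHom_eq_zero_iff D DQ hres hvp x).1 hx')
    refine ⟨b, DQ.bijective.1 ?_⟩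
    rw [LinearMap.comp_apply, Submodule.subtype_apply, hjn b, hb]
  · rintro ⟨b, rfl⟩
    rw [LinearMap.comp_apply, Submodule.subtype_apply]
    exact (jn b).2

end J3Exact

end Summit.BirchSwinnertonDyer.BirchSwinnertonDyer.Theorems.SmallImageRttD2Seq

end
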